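import Literature.IUT.HodgeArakelov.MonoThetaProp13Sub
import Literature.IUT.HodgeArakelov.MonoThetaFromGroupsProp13GenuineCoincide

/-!
# [IUTchII] Proposition 1.3 (iii), sub-DAG row r1 at the GENUINE `M^Θ(𝒞)`: the [EtTh] Lemma 5.9 (v) input supplied

S. Mochizuki, *Inter-universal Teichmüller theory II*, §1, Proposition 1.3 (iii) and its proof, kurims manuscript
(Dec. 2020) p. 27 l. 1–7 [claim: Mochizuki2012, status: disputed] (IUTchII §1 Prop 1.3 (iii), kurims p.27): "both
isomorphisms `(*mono-Θ)`, `(*bs-Gal)` coincide with the conventional identification between the cyclotomes involved that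
arises from conventional scheme theory."  abc-iut cell, DAG node `IUTchII:Prop1.3(iii)`, sub-DAG
`plan/L6/SUBDAG-IUTchII-Prop-13iii.md` (abc-iut-w5-d064; statements file `MonoThetaProp13Sub.lean` p413560), discharge
seat abc-iut-w4-d042 (gen 2).  PROOF-ONLY (no `def`, no new named fact).

Row r1 «`(*mono-Θ)` coincides with the conventional identification» was reduced by abc-iut-w5-d064
(`Prop13Sub.monoThetaConventional_of_rho`) to [EtTh] Lemma 5.9 (v) for the slot `a⁻¹ ≫ (*mono-Θ) ≫ b` (hypothesis
`h59v`) plus «`ρ_{B_N}` is conventional» (`hρ`).  At the GENUINE Prop. 1.2 (ii) output `M^Θ(𝒞) = E^Π_N`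
(`EnvOfFrobenioid.ofBiTheta`, p416299) with ITS Def. 1.1 (ii) isomorphism (bridge B8's `ModelFrame.cyclotomicRigidity`
read through the bi-theta isomorphism of [EtTh] Lemma 5.9 (iv)) that `h59v` is a THEOREM
(`cycRigidityCoincide_monoTheta_ofBiTheta`, p417895, from the pointwise Lemma 5.9 (v) of
`EtaleTheta/Discharge/Sec5Lem59vTransport.lean`, p417589).  Hence:

* `monoThetaConventional_ofBiTheta_of_rho` — r1 at the genuine object ⟸ `hρ` alone (given Prop. 5.5 BY NAME
  `IsKummerDetermined`, the bi-theta isomorphism `i`/`hi`/`hYdd`, and the readings `ha`/`hb`/`hcov` of p417895);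
* `prop13_iii_ofBiTheta_of_subnodes` — the sub-DAG ASSEMBLY at the genuine object: Prop. 1.3 (iii) ⟸
  {`hρ`, r2 `Cor110cNatural`, r3 `Rmk321Natural`, r4a, r4b} relative to a pinned `κ` — exactly the [AbsTopIII] /
  correspondence side (plan/GAP-LEDGER G-w4d042-1; [AbsTopIII] Cor. 1.10 FACT-policy), no [EtTh] Lemma 5.9 (v)
  hypothesis.

HONEST FRAMING: kernel-checked composition of landed theorems; the vacuity caveat of p413560 (`ConventionalCyclotomes`
is a binder; at the tautological `κ := ofBsGal` the sub-nodes are (iii) restated) applies verbatim; nothing here bears on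
[IUTchIII] Cor. 3.12 and no side is taken; typed ≠ proved elsewhere.
-/

noncomputable section

namespace Literature.IUT.HodgeArakelov

namespace Prop13Sub

universe w u

open CategoryTheory Literature.AnabelianGeometry.EtaleTheta
open scoped Literature.AnabelianGeometry.EtaleTheta

variable {S : ThetaSetting.{u}} {l : ℕ} {R : RigidData.{u} S.N l}
variable {C : Type (u + 1)} [Category.{u} C] {D : Type (u + 1)} [Category.{u} D]
  (𝔉 : ThetaFrobenioid.{w} C D) (h1 : 𝔉.SectionsFactor) (h3 : 𝔉.OuterActionLZ)
  (hsec : 𝔉.SgpCapSection) (hcs : 𝔉.SgpCupSection) (h8 : 𝔉.ConstantsEqNormalizer)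
  (DK : Set (TopOut 𝔉.EPiN))
  (h218ii : R.toThetaEnvData.Cor218_ii) (A : ModelAgreement S R.toThetaEnvData)
  {η : R.PiYdd → R.mu} (hη : η ∈ R.thetaCocycles)
  (i : (𝔉.frdBiThetaEnv h1 h3 hsec hcs h8 DK).Iso (R.toThetaEnvData.modelBi hη))
  (F : ModelFrame S R) (e : D ≌ BTemp0 S.PiX) (ι : 𝔉.PiX ≃ₜ* R.PiX)
  (hi : ∀ x : 𝔉.EPiN, ((CycEnvelope.proj R.augY R.chi (i.e x) : R.PiY) : R.PiX) = ι (𝔉.toPiY x))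
  (hYdd : 𝔉.PiYdd.map ι.toMonoidHom = R.PiYdd)
  (P : FrobenioidCyclotomicRigidity.ThetaSubquotientProj 𝔉) (ρ : FrobenioidCyclotomicRigidity.RigidityFamily 𝔉)
  (hB : 𝔉.IsThetaSaturated 𝔉.BN) (hρ : FrobenioidCyclotomicRigidity.IsKummerDetermined 𝔉 P ρ hB)
  {Z : FrobenioidCyclotomes (EnvOfFrobenioid.ofBiTheta 𝔉 h1 h3 hsec hcs h8 DK h218ii A hη i F
    (TemperedFrobenioidData.ofThetaFrobenioid S 𝔉 e))}
  (a : Z.intS.carrier ≃* 𝔉.lDeltaModN 𝔉.BN) (b : Z.muN ≃* 𝔉.muTorsion 𝔉.BN 𝔉.N)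
  (hb : ∀ x, b (Z.corrExt x) = corrExtOfBiTheta 𝔉 h1 h3 hsec hcs h8 DK h218ii A hη i F _ ι hi x)
  (ha : ∀ (y : 𝔉.PiYdd) (hy : ι (y : 𝔉.PiX) ∈ R.lDeltaTheta)
    (hh : ((𝔉.rhoYdd y : 𝔉.HB) : Aut (𝔉.base.obj 𝔉.BN)) ∈ P.pre (𝔉.base.obj 𝔉.BN)),
    a (Z.corrInt (((ModelCyclotomes.intCycEquiv R).symm
      ((⟨ι (y : 𝔉.PiX), hy⟩ : R.lDeltaTheta) : ModelCyclotomes.lDeltaQuot R) :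
        (ModelCyclotomes.intCyc R).carrier) : ModPow (ModelCyclotomes.intCyc R).carrier (S.N : ℕ))) =
      (QuotientGroup.mk (P.proj _ ⟨_, hh⟩) : 𝔉.lDeltaModN 𝔉.BN))
  (hcov : ∀ x : 𝔉.lDeltaModN 𝔉.BN, ∃ (y : 𝔉.PiYdd) (_ : ι (y : 𝔉.PiX) ∈ R.lDeltaTheta)
    (hh : ((𝔉.rhoYdd y : 𝔉.HB) : Aut (𝔉.base.obj 𝔉.BN)) ∈ P.pre (𝔉.base.obj 𝔉.BN)),
    (QuotientGroup.mk (P.proj _ ⟨_, hh⟩) : 𝔉.lDeltaModN 𝔉.BN) = x)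
  {B : BsGalData Z} {ν' : Type w} [Group ν'] (κ : ConventionalCyclotomes Z B ν')
  (hρc : ∀ x, κ.idMuN (b.symm (ρ 𝔉.BN hB (a x))) = κ.idIntS x)

include hi hYdd hρ hb ha hcov hρc in
/-- **Sub-DAG row r1 at the GENUINE `M^Θ(𝒞)`** («`(*mono-Θ)` coincides with the conventional identification», proof of
Prop. 1.3 (iii), p. 27 l. 5–6): abc-iut-w5-d064's `MonoThetaConventional` for the genuine Def. 1.1 (ii) isomorphism
`C₀` holds as soon as «`ρ_{B_N}` is conventional» (`hρc`) — its [EtTh] Lemma 5.9 (v) input is the THEOREM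
`cycRigidityCoincide_monoTheta_ofBiTheta`. [claim: Mochizuki2012, status: disputed] (IUTchII §1 Prop 1.3 (iii), kurims p.27 l.5–6) -/
theorem monoThetaConventional_ofBiTheta_of_rho :
    MonoThetaConventional (F.cyclotomicRigidity (isoModelOfBiTheta 𝔉 h1 h3 hsec hcs h8 DK h218ii A hη i).e) κ :=
  monoThetaConventional_of_rho 𝔉 hB ρ _ a b
    (cycRigidityCoincide_monoTheta_ofBiTheta 𝔉 h1 h3 hsec hcs h8 DK h218ii A hη i F _ ι hi hYdd P ρ hB hρ Z a b
      hb ha hcov) κ hρc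

include hi hYdd hρ hb ha hcov hρc in
/-- **The sub-DAG of [IUTchII] Prop. 1.3 (iii) ASSEMBLED at the GENUINE `M^Θ(𝒞)`**: `Prop13_iii C₀ Z B` ⟸ {`hρc`
(«`ρ_{B_N}` conventional»), r2 `Cor110cNatural` ([AbsTopIII] Cor. 1.10 (c)), r3 `Rmk321Natural` ([AbsTopIII] Rmk. 3.2.1),
r4a `CorrMuNConventional`, r4b `CorrIntSConventional`} relative to a pinned `κ` (abc-iut-w5-d064's
`prop13_iii_of_subnodes` with r1 := `monoThetaConventional_ofBiTheta_of_rho`). The remaining inputs are the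
[AbsTopIII]/correspondence side of plan/GAP-LEDGER G-w4d042-1 only. [claim: Mochizuki2012, status: disputed]
(IUTchII §1 Prop 1.3 (iii), kurims p.27 l.1–7) -/
theorem prop13_iii_ofBiTheta_of_subnodes (hr2 : Cor110cNatural κ) (hr3 : Rmk321Natural κ)
    (hr4a : CorrMuNConventional κ) (hr4b : CorrIntSConventional κ) :
    Prop13_iii (F.cyclotomicRigidity (isoModelOfBiTheta 𝔉 h1 h3 hsec hcs h8 DK h218ii A hη i).e) Z B :=
  prop13_iii_of_subnodes _ κ
    (monoThetaConventional_ofBiTheta_of_rho 𝔉 h1 h3 hsec hcs h8 DK h218ii A hη i F e ι hi hYdd P ρ hB hρ a b hb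
      ha hcov κ hρc) hr2 hr3 hr4a hr4b

end Prop13Sub

end Literature.IUT.HodgeArakelov

end
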